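import Literature.MathematicalPhysics.QuantumFieldTheory.Balaban1983to89.Setup
import HarnessLib

/-!
# `AlphaInputsT3ACv3SphereAxialGaugeDisc` — non-abelian (FL), START v3 row (S3), part 1: **THE COMB-AXIAL TREE GAUGE ON THE FIVE-FACE DISC OF A LATTICE CUBE** — on the model box
# `[−R, R]³ ⊂ ℤ³` (torus-free, any gauge group with the `dist1` interface) the tree gauge `σ_T(x,y,z) := W(X^{x+R} Y^{y+R} Z^{z+R})` from the corner `(−R,−R,−R)` (spine along `x`, bottom-face
# teeth along `y`, vertical teeth along `z`) gauges every `z`-bond to `1`, every `y`-bond at height `t = z+R` to the holonomy of a `1×t` LADDER in its `(y,z)`-plane (`≤ t·b`), and every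
# `x`-bond at height `t` and depth `c = y+R` to a conjugated product of two ladders (`≤ (t+c)·b`) — so on the bottom face and the four side faces of the cube every tangential bond is within
# `4R·b` of `1` when the plaquettes OF THOSE FACES are within `b` — cell `ym3-torus`, width seat `ym-ust-19936-w5` (g2), row (S3) of ★w1-19936 g2 LEAD memo `NONABELIAN-FL-START-w1-g2.md` §4

WHY (OWNER RULING 19936 (FL) START 2026-08-28T02:16:33Z, START v3 of record; LEAD memo §3 (B) «BALL around an interior vertex: boundary data on `∂Q` …; Filling: comb-axial gauge `σ` on the
lattice sphere `∂Q` (`|mlog data^σ| ≤ 6R·b` per bond — uniformly small)»; carriers fixed by the LEAD 02:22:38Z: model sites `u : Fin d → ℤ`, d = 3 literal).  The closed surface `∂Q` is a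
2-sphere and NO spanning-tree gauge of its bond graph can be uniformly `O(R·b)`-flat (the dual tree of the non-tree bonds has a centroid edge whose fundamental cycle bounds `Θ(R²)`
plaquettes on either side; sign-alternating curvature of total flux zero makes that holonomy `Θ(R²b)` — this seat's LOCATED point 03:0xZ).  The construction of record therefore is: a TREE
gauge on the five-face DISC `∂Q ∖ {z = R}` (this file — pure group bookkeeping, every bound a sum of plaquette deviations along thin ladders), followed by a transfinite (Coons) SPREADING of
the top-face mismatch (part 2, `…SphereAxialGauge`, matrices).  Internal coordinates are natural OFFSETS `(a, s, t)` from the corner: site `(−R+a, −R+s, −R+t)`.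
WHAT.  §1 `lprod` (ordered product `f 0 · f 1 ⋯ f (k−1)`; one def), `lprod_succ_shift`, ★ `dist1_ladder_le` (the loop `ν^t μ ν^{−t} μ^{−1}`: `dist1 ≤ Σ` of its `t` plaquettes — induction
through `L_{t+1}(u) = f₀·L_t(u+e_ν)·f₀⁻¹ · plaq(u)`, `dist1_conj`, `dist1_mul_le`).  §2 the model field `W : ℤ → ℤ → ℤ → Fin 3 → G` (bond from `(x,y,z)` in direction `μ`): straight
transports `holX/holY/holZ` (defs via `lprod`), plaquettes `pXY/pYZ/pXZ` (defs; tree orientation `W₁W₂W₃⁻¹W₄⁻¹`), the three ladder instances `dist1_ladderYX_le`, `dist1_ladderZY_le`,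
`dist1_ladderZX_le`.  §3 the tree gauge `sigmaT W R a s t` (def) and its gauged bonds: `sigmaT_succ_t` (z-bonds gauge to `1`: `gaugedZ_eq_one`), `sigmaT_succ_s_zero`, `sigmaT_succ_a_zero`
(tree identities), ★★ `dist1_gaugedY_le` (`≤ t·b` from the `(y,z)`-ladder below the bond), ★★ `dist1_gaugedX_le` (`≤ t·b + c·b` from the `(x,z)`-ladder below the bond conjugated by the
bottom `y`-tooth, times the bottom `(x,y)`-ladder).  No smallness, no matrices; `R`, the faces and the box enter only part 2, where the plaquette hypotheses are discharged from «boundary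
plaquettes ≤ b».
HONEST FRAMING.  Group bookkeeping; count-neutral helper toward R3 2′ (items 19936∕19935, `--supports stmt-QuantumFields-19936`); (S3) is completed by part 2; `hLift`∕(FL), the stub
`stub_laneRecordsV3Chi`, the crux `HistoryTailL` and the gap are NOT claimed; registry untouched; YM₃ on T³ is rung R3 of the YM ladder, not the Clay problem.

References: T. Bałaban, Commun. Math. Phys. 98 (1985) 17–51 [Balaban1985Averaging] ((8)–(9) p.18, (19)–(20) p.21, pp.24–25: axial gauges along combs, bond variables from plaquettes);
Commun. Math. Phys. 99 (1985) 75–102 [Balaban1985RegularSpaces] (Lemma 1 (1.24)–(1.25) p.79); Commun. Math. Phys. 102 (1985) 277–309 [Balaban1985Variational] ((18) p.280).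
-/

set_option autoImplicit false

namespace Summit.QuantumFields.YangMills.Theorems.SphereAxialGauge

open Literature.MathematicalPhysics.QuantumFieldTheory.Balaban1983to89

variable {G : Type*} [GaugeGroup G]

/-! ## §1 Ordered products and the ladder loop -/

/-- The ordered product `f 0 · f 1 ⋯ f (k−1)` (parallel transport along `k` consecutive bonds). [cite: Balaban1985Averaging, (8) p.18] -/
def lprod (f : ℕ → G) : ℕ → G
  | 0 => 1
  | k + 1 => lprod f k * f k

omit [GaugeGroup G] in
/-- `lprod f 0 = 1`. [folklore] -/
theorem lprod_zero [GaugeGroup G] (f : ℕ → G) : lprod f 0 = 1 := rfl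

omit [GaugeGroup G] in
/-- `lprod f (k+1) = lprod f k · f k`. [folklore] -/
theorem lprod_succ [GaugeGroup G] (f : ℕ → G) (k : ℕ) : lprod f (k + 1) = lprod f k * f k := rfl

/-- The first factor split off: `lprod f (k+1) = f 0 · lprod (f ∘ succ) k`. [folklore] -/
theorem lprod_succ_shift (f : ℕ → G) : ∀ k : ℕ, lprod f (k + 1) = f 0 * lprod (fun i => f (i + 1)) k
  | 0 => by simp [lprod]
  | k + 1 => by rw [lprod_succ, lprod_succ_shift f k, lprod_succ, mul_assoc]

/-- **★ THE LADDER**: the loop `ν^t μ ν^{−t} μ^{−1}` — left column `f`, right column `g`, rungs `h` — deviates from `1` by at most the sum of the deviations of its `t` plaquettes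
`f i · h (i+1) · (g i)⁻¹ · (h i)⁻¹` (non-abelian Stokes for a strip of width one: `L_{t+1} = f₀ · L_t(shifted) · f₀⁻¹ · plaq₀`). [cite: Balaban1985Averaging, (8)–(9) p.18, pp.24–25] -/
theorem dist1_ladder_le (b : ℝ) : ∀ (t : ℕ) (f g h : ℕ → G), (∀ i, i < t → dist1 (f i * h (i + 1) * (g i)⁻¹ * (h i)⁻¹) ≤ b) →
    dist1 (lprod f t * h t * (lprod g t)⁻¹ * (h 0)⁻¹) ≤ t * b
  | 0, f, g, h, _ => by simp [lprod, GaugeGroup.dist1_one]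
  | t + 1, f, g, h, hp => by
    have ih := dist1_ladder_le b t (fun i => f (i + 1)) (fun i => g (i + 1)) (fun i => h (i + 1)) (fun i hi => hp (i + 1) (by omega))
    have e : lprod f (t + 1) * h (t + 1) * (lprod g (t + 1))⁻¹ * (h 0)⁻¹ =
        f 0 * (lprod (fun i => f (i + 1)) t * h (t + 1) * (lprod (fun i => g (i + 1)) t)⁻¹ * (h 1)⁻¹) * (f 0)⁻¹ * (f 0 * h 1 * (g 0)⁻¹ * (h 0)⁻¹) := by
      rw [lprod_succ_shift f t, lprod_succ_shift g t]; group
    rw [e]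
    calc dist1 (f 0 * (lprod (fun i => f (i + 1)) t * h (t + 1) * (lprod (fun i => g (i + 1)) t)⁻¹ * (h 1)⁻¹) * (f 0)⁻¹ * (f 0 * h 1 * (g 0)⁻¹ * (h 0)⁻¹))
        ≤ dist1 (f 0 * (lprod (fun i => f (i + 1)) t * h (t + 1) * (lprod (fun i => g (i + 1)) t)⁻¹ * (h 1)⁻¹) * (f 0)⁻¹) + dist1 (f 0 * h 1 * (g 0)⁻¹ * (h 0)⁻¹) :=
          GaugeGroup.dist1_mul_le _ _
      _ = dist1 (lprod (fun i => f (i + 1)) t * h (t + 1) * (lprod (fun i => g (i + 1)) t)⁻¹ * (h 1)⁻¹) + dist1 (f 0 * h 1 * (g 0)⁻¹ * (h 0)⁻¹) := by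
          rw [GaugeGroup.dist1_conj]
      _ ≤ t * b + b := add_le_add ih (hp 0 (by omega))
      _ = ((t + 1 : ℕ) : ℝ) * b := by push_cast; ring

/-! ## §2 The model field on `ℤ³`: straight transports, plaquettes, ladder instances -/

section Model

variable (W : ℤ → ℤ → ℤ → Fin 3 → G)

/-- Transport along `k` consecutive `x`-bonds from `(x,y,z)`. [cite: Balaban1985Averaging, (8) p.18] -/
def holX (x y z : ℤ) (k : ℕ) : G := lprod (fun i : ℕ => W (x + i) y z 0) k

/-- Transport along `k` consecutive `y`-bonds from `(x,y,z)`. [cite: Balaban1985Averaging, (8) p.18] -/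
def holY (x y z : ℤ) (k : ℕ) : G := lprod (fun i : ℕ => W x (y + i) z 1) k

/-- Transport along `k` consecutive `z`-bonds from `(x,y,z)`. [cite: Balaban1985Averaging, (8) p.18] -/
def holZ (x y z : ℤ) (k : ℕ) : G := lprod (fun i : ℕ => W x y (z + i) 2) k

/-- The `(x,y)`-plaquette at `(x,y,z)`: `W₀(x,y,z)·W₁(x+1,y,z)·W₀(x,y+1,z)⁻¹·W₁(x,y,z)⁻¹`. [cite: Balaban1985Averaging, (9) p.18] -/
def pXY (x y z : ℤ) : G := W x y z 0 * W (x + 1) y z 1 * (W x (y + 1) z 0)⁻¹ * (W x y z 1)⁻¹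

/-- The `(y,z)`-plaquette at `(x,y,z)`. [cite: Balaban1985Averaging, (9) p.18] -/
def pYZ (x y z : ℤ) : G := W x y z 1 * W x (y + 1) z 2 * (W x y (z + 1) 1)⁻¹ * (W x y z 2)⁻¹

/-- The `(x,z)`-plaquette at `(x,y,z)`. [cite: Balaban1985Averaging, (9) p.18] -/
def pXZ (x y z : ℤ) : G := W x y z 0 * W (x + 1) y z 2 * (W x y (z + 1) 0)⁻¹ * (W x y z 2)⁻¹

/-- `holX` one more step. [folklore] -/
theorem holX_succ (x y z : ℤ) (k : ℕ) : holX W x y z (k + 1) = holX W x y z k * W (x + k) y z 0 := rfl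

/-- `holY` one more step. [folklore] -/
theorem holY_succ (x y z : ℤ) (k : ℕ) : holY W x y z (k + 1) = holY W x y z k * W x (y + k) z 1 := rfl

/-- `holZ` one more step. [folklore] -/
theorem holZ_succ (x y z : ℤ) (k : ℕ) : holZ W x y z (k + 1) = holZ W x y z k * W x y (z + k) 2 := rfl

/-- `holX W x y z 0 = 1`, similarly `holY`, `holZ`. [folklore] -/
theorem hol_zero (x y z : ℤ) : holX W x y z 0 = 1 ∧ holY W x y z 0 = 1 ∧ holZ W x y z 0 = 1 := ⟨rfl, rfl, rfl⟩

/-- **THE `(y,x)`-LADDER**: `dist1(Y^s X Y^{−s} X^{−1}) ≤ s·b` at `(x,y₀,z)` from the `s` plaquettes `pXY x (y₀+i) z`. [cite: Balaban1985Averaging, (8)–(9) p.18, pp.24–25] -/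
theorem dist1_ladderYX_le (x y₀ z : ℤ) (s : ℕ) {b : ℝ} (hp : ∀ i : ℕ, i < s → dist1 (pXY W x (y₀ + i) z) ≤ b) :
    dist1 (holY W x y₀ z s * W x (y₀ + s) z 0 * (holY W (x + 1) y₀ z s)⁻¹ * (W x y₀ z 0)⁻¹) ≤ s * b := by
  have h := dist1_ladder_le b s (fun i : ℕ => W x (y₀ + i) z 1) (fun i : ℕ => W (x + 1) (y₀ + i) z 1) (fun i : ℕ => W x (y₀ + i) z 0) (fun i hi => by
    have e : W x (y₀ + (i : ℕ)) z 1 * W x (y₀ + ((i + 1 : ℕ) : ℤ)) z 0 * (W (x + 1) (y₀ + (i : ℕ)) z 1)⁻¹ * (W x (y₀ + (i : ℕ)) z 0)⁻¹ = (pXY W x (y₀ + i) z)⁻¹ := by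
      simp only [pXY, Nat.cast_succ, ← add_assoc]; group
    rw [e, GaugeGroup.dist1_inv]; exact hp i hi)
  simpa only [holY, Nat.cast_zero, add_zero] using h

/-- **THE `(z,y)`-LADDER**: `dist1(Z^t Y Z^{−t} Y^{−1}) ≤ t·b` at `(x,y,z₀)` from the `t` plaquettes `pYZ x y (z₀+i)`. [cite: Balaban1985Averaging, (8)–(9) p.18, pp.24–25] -/
theorem dist1_ladderZY_le (x y z₀ : ℤ) (t : ℕ) {b : ℝ} (hp : ∀ i : ℕ, i < t → dist1 (pYZ W x y (z₀ + i)) ≤ b) :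
    dist1 (holZ W x y z₀ t * W x y (z₀ + t) 1 * (holZ W x (y + 1) z₀ t)⁻¹ * (W x y z₀ 1)⁻¹) ≤ t * b := by
  have h := dist1_ladder_le b t (fun i : ℕ => W x y (z₀ + i) 2) (fun i : ℕ => W x (y + 1) (z₀ + i) 2) (fun i : ℕ => W x y (z₀ + i) 1) (fun i hi => by
    have e : W x y (z₀ + (i : ℕ)) 2 * W x y (z₀ + ((i + 1 : ℕ) : ℤ)) 1 * (W x (y + 1) (z₀ + (i : ℕ)) 2)⁻¹ * (W x y (z₀ + (i : ℕ)) 1)⁻¹ = (pYZ W x y (z₀ + i))⁻¹ := by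
      simp only [pYZ, Nat.cast_succ, ← add_assoc]; group
    rw [e, GaugeGroup.dist1_inv]; exact hp i hi)
  simpa only [holZ, Nat.cast_zero, add_zero] using h

/-- **THE `(z,x)`-LADDER**: `dist1(Z^t X Z^{−t} X^{−1}) ≤ t·b` at `(x,y,z₀)` from the `t` plaquettes `pXZ x y (z₀+i)`. [cite: Balaban1985Averaging, (8)–(9) p.18, pp.24–25] -/
theorem dist1_ladderZX_le (x y z₀ : ℤ) (t : ℕ) {b : ℝ} (hp : ∀ i : ℕ, i < t → dist1 (pXZ W x y (z₀ + i)) ≤ b) :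
    dist1 (holZ W x y z₀ t * W x y (z₀ + t) 0 * (holZ W (x + 1) y z₀ t)⁻¹ * (W x y z₀ 0)⁻¹) ≤ t * b := by
  have h := dist1_ladder_le b t (fun i : ℕ => W x y (z₀ + i) 2) (fun i : ℕ => W (x + 1) y (z₀ + i) 2) (fun i : ℕ => W x y (z₀ + i) 0) (fun i hi => by
    have e : W x y (z₀ + (i : ℕ)) 2 * W x y (z₀ + ((i + 1 : ℕ) : ℤ)) 0 * (W (x + 1) y (z₀ + (i : ℕ)) 2)⁻¹ * (W x y (z₀ + (i : ℕ)) 0)⁻¹ = (pXZ W x y (z₀ + i))⁻¹ := by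
      simp only [pXZ, Nat.cast_succ, ← add_assoc]; group
    rw [e, GaugeGroup.dist1_inv]; exact hp i hi)
  simpa only [holZ, Nat.cast_zero, add_zero] using h

/-! ## §3 The tree gauge from the corner and its gauged bonds -/

/-- **THE TREE GAUGE** `σ_T(−R+a, −R+s, −R+t) := W(X^a Y^s Z^t)`: transport from the corner `(−R,−R,−R)` along `a` `x`-bonds (the spine), then `s` `y`-bonds (bottom-face tooth), then `t`
`z`-bonds (vertical tooth).  Every site of the bottom face and of the four side faces of `[−R,R]³` is reached INSIDE those faces. [cite: Balaban1985Averaging, pp.24–25; Balaban1985RegularSpaces, (1.24) p.79] -/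
def sigmaT (R : ℕ) (a s t : ℕ) : G :=
  holX W (-(R : ℤ)) (-(R : ℤ)) (-(R : ℤ)) a * holY W (-(R : ℤ) + a) (-(R : ℤ)) (-(R : ℤ)) s * holZ W (-(R : ℤ) + a) (-(R : ℤ) + s) (-(R : ℤ)) t

variable (R : ℕ)

/-- One more vertical step: `σ_T(a,s,t+1) = σ_T(a,s,t) · W_z(−R+a, −R+s, −R+t)`. [cite: Balaban1985Averaging, (8) p.18] -/
theorem sigmaT_succ_t (a s t : ℕ) : sigmaT W R a s (t + 1) = sigmaT W R a s t * W (-(R : ℤ) + a) (-(R : ℤ) + s) (-(R : ℤ) + t) 2 := by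
  simp only [sigmaT, holZ_succ, mul_assoc]

/-- One more bottom-face step: `σ_T(a,s+1,0) = σ_T(a,s,0) · W_y(−R+a, −R+s, −R)`. [cite: Balaban1985Averaging, (8) p.18] -/
theorem sigmaT_succ_s_zero (a s : ℕ) : sigmaT W R a (s + 1) 0 = sigmaT W R a s 0 * W (-(R : ℤ) + a) (-(R : ℤ) + s) (-(R : ℤ)) 1 := by
  simp only [sigmaT, holY_succ, holZ, lprod, mul_one, mul_assoc]

/-- One more spine step: `σ_T(a+1,0,0) = σ_T(a,0,0) · W_x(−R+a, −R, −R)`. [cite: Balaban1985Averaging, (8) p.18] -/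
theorem sigmaT_succ_a_zero (a : ℕ) : sigmaT W R (a + 1) 0 0 = sigmaT W R a 0 0 * W (-(R : ℤ) + a) (-(R : ℤ)) (-(R : ℤ)) 0 := by
  simp only [sigmaT, holX_succ, holY, holZ, lprod, mul_one]

/-- **VERTICAL BONDS GAUGE TO `1`**: `σ_T(a,s,t) · W_z · σ_T(a,s,t+1)⁻¹ = 1`. [cite: Balaban1985Averaging, pp.24–25] -/
theorem gaugedZ_eq_one (a s t : ℕ) : sigmaT W R a s t * W (-(R : ℤ) + a) (-(R : ℤ) + s) (-(R : ℤ) + t) 2 * (sigmaT W R a s (t + 1))⁻¹ = 1 := by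
  rw [sigmaT_succ_t]; group

/-- **★★ `y`-BONDS**: at height `t` the gauged `y`-bond `σ_T(a,s,t)·W_y(−R+a,−R+s,−R+t)·σ_T(a,s+1,t)⁻¹` is conjugate to the `(z,y)`-ladder standing on the bottom tooth, hence within `t·b`
of `1` when that ladder's plaquettes `pYZ (−R+a) (−R+s) (−R+i)`, `i < t`, are (on a side face `a ∈ {0, 2R}` these are plaquettes OF that face). [cite: Balaban1985Averaging, (8)–(9) p.18, pp.24–25] -/
theorem dist1_gaugedY_le (a s t : ℕ) {b : ℝ} (hp : ∀ i : ℕ, i < t → dist1 (pYZ W (-(R : ℤ) + a) (-(R : ℤ) + s) (-(R : ℤ) + i)) ≤ b) :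
    dist1 (sigmaT W R a s t * W (-(R : ℤ) + a) (-(R : ℤ) + s) (-(R : ℤ) + t) 1 * (sigmaT W R a (s + 1) t)⁻¹) ≤ t * b := by
  have hlad := dist1_ladderZY_le W (-(R : ℤ) + a) (-(R : ℤ) + s) (-(R : ℤ)) t hp
  have e : sigmaT W R a s t * W (-(R : ℤ) + a) (-(R : ℤ) + s) (-(R : ℤ) + t) 1 * (sigmaT W R a (s + 1) t)⁻¹ =
      (holX W (-(R : ℤ)) (-(R : ℤ)) (-(R : ℤ)) a * holY W (-(R : ℤ) + a) (-(R : ℤ)) (-(R : ℤ)) s) *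
        (holZ W (-(R : ℤ) + a) (-(R : ℤ) + s) (-(R : ℤ)) t * W (-(R : ℤ) + a) (-(R : ℤ) + s) (-(R : ℤ) + t) 1 *
          (holZ W (-(R : ℤ) + a) (-(R : ℤ) + s + 1) (-(R : ℤ)) t)⁻¹ * (W (-(R : ℤ) + a) (-(R : ℤ) + s) (-(R : ℤ)) 1)⁻¹) *
        (holX W (-(R : ℤ)) (-(R : ℤ)) (-(R : ℤ)) a * holY W (-(R : ℤ) + a) (-(R : ℤ)) (-(R : ℤ)) s)⁻¹ := by
    simp only [sigmaT, holY_succ, Nat.cast_succ, ← add_assoc]; group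
  rw [e, GaugeGroup.dist1_conj]
  exact hlad

/-- **★★ `x`-BONDS**: at height `t` and depth `c` the gauged `x`-bond `σ_T(a,c,t)·W_x(−R+a,−R+c,−R+t)·σ_T(a+1,c,t)⁻¹` is a conjugate of [the `(z,x)`-ladder standing on the bottom face,
conjugated by the bottom tooth] · [the bottom `(y,x)`-ladder between the teeth `a` and `a+1`], hence within `t·b + c·b` of `1` when those plaquettes are (on the faces `y = ±R`, `c ∈ {0,2R}`,
the first ladder lies in that face and the second in the bottom face; `t = 0` is the bottom face itself). [cite: Balaban1985Averaging, (8)–(9) p.18, pp.24–25] -/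
theorem dist1_gaugedX_le (a c t : ℕ) {b : ℝ}
    (hpZ : ∀ i : ℕ, i < t → dist1 (pXZ W (-(R : ℤ) + a) (-(R : ℤ) + c) (-(R : ℤ) + i)) ≤ b)
    (hpY : ∀ i : ℕ, i < c → dist1 (pXY W (-(R : ℤ) + a) (-(R : ℤ) + i) (-(R : ℤ))) ≤ b) :
    dist1 (sigmaT W R a c t * W (-(R : ℤ) + a) (-(R : ℤ) + c) (-(R : ℤ) + t) 0 * (sigmaT W R (a + 1) c t)⁻¹) ≤ t * b + c * b := by
  have hlad1 := dist1_ladderZX_le W (-(R : ℤ) + a) (-(R : ℤ) + c) (-(R : ℤ)) t hpZ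
  have hlad2 := dist1_ladderYX_le W (-(R : ℤ) + a) (-(R : ℤ)) (-(R : ℤ)) c hpY
  -- names
  set HX : G := holX W (-(R : ℤ)) (-(R : ℤ)) (-(R : ℤ)) a with hHX
  set HY : G := holY W (-(R : ℤ) + a) (-(R : ℤ)) (-(R : ℤ)) c with hHY
  set HY' : G := holY W (-(R : ℤ) + a + 1) (-(R : ℤ)) (-(R : ℤ)) c with hHY'
  set HZ : G := holZ W (-(R : ℤ) + a) (-(R : ℤ) + c) (-(R : ℤ)) t with hHZ
  set HZ' : G := holZ W (-(R : ℤ) + a + 1) (-(R : ℤ) + c) (-(R : ℤ)) t with hHZ'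
  set Wb : G := W (-(R : ℤ) + a) (-(R : ℤ) + c) (-(R : ℤ) + t) 0 with hWb
  set Wm : G := W (-(R : ℤ) + a) (-(R : ℤ) + c) (-(R : ℤ)) 0 with hWm
  set W0 : G := W (-(R : ℤ) + a) (-(R : ℤ)) (-(R : ℤ)) 0 with hW0
  have e1 : sigmaT W R a c t = HX * HY * HZ := rfl
  have e2 : sigmaT W R (a + 1) c t = HX * W0 * HY' * HZ' := by
    simp only [sigmaT, holX_succ, hHX, hW0, hHY', hHZ', Nat.cast_succ, ← add_assoc]
  have e : sigmaT W R a c t * Wb * (sigmaT W R (a + 1) c t)⁻¹ =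
      HX * ((HY * (HZ * Wb * HZ'⁻¹ * Wm⁻¹) * HY⁻¹) * (HY * Wm * HY'⁻¹ * W0⁻¹)) * HX⁻¹ := by
    rw [e1, e2]; group
  rw [e, GaugeGroup.dist1_conj]
  have hl1 : dist1 (HZ * Wb * HZ'⁻¹ * Wm⁻¹) ≤ t * b := by
    simpa only [hHZ, hWb, hHZ', hWm, add_zero] using hlad1
  have hl2 : dist1 (HY * Wm * HY'⁻¹ * W0⁻¹) ≤ c * b := by
    simpa only [hHY, hWm, hHY', hW0, add_zero] using hlad2
  calc dist1 ((HY * (HZ * Wb * HZ'⁻¹ * Wm⁻¹) * HY⁻¹) * (HY * Wm * HY'⁻¹ * W0⁻¹))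
      ≤ dist1 (HY * (HZ * Wb * HZ'⁻¹ * Wm⁻¹) * HY⁻¹) + dist1 (HY * Wm * HY'⁻¹ * W0⁻¹) := GaugeGroup.dist1_mul_le _ _
    _ ≤ t * b + c * b := by rw [GaugeGroup.dist1_conj]; exact add_le_add hl1 hl2

end Model

end Summit.QuantumFields.YangMills.Theorems.SphereAxialGauge
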